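/-
Copyright: lit-balaban cell, Phase-2 proof seat p33 (gen 11).  Statement-level skeleton of a published paper; no proof claims beyond
what the kernel checks below.
-/
import Literature.MathematicalPhysics.QuantumFieldTheory.BalabanImbrieJaffe1984to88.BIJ85LineSumReflectionD

/-!
# `BalabanImbrieJaffe1984to88.BIJ85Claim73AllCouplings` — T. Bałaban, J. Imbrie, A. Jaffe, *Renormalization of the Higgs model:
minimizers, propagators and the stability of mean field theory*, Commun. Math. Phys. **97** (1985) 299–329 [BalabanImbrieJaffe1985],
§7.3 p. 326: **r15's typed claim `Claim73 𝓅` — "(7.3.1) ⇒ (7.3.2) for constants γ > 0, α > 0, M < ∞" — in BOTH printed forms, for the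
family of ALL actual Sect. 7.3 data of every torus of a given dimension `d ≥ 2` and block size `L`: every scale `1 ≤ k ≤ m + K`, EVERY
coupling `0 < e_k ≤ 1`, every unit-lattice `U(1)` field `v` — with NO located hypothesis and NO regime qualifier** (file 3 of the gen-11
member of SKELETON row **C1.Eq7.3.1-7.3.2**; owner r15, referee ref-5).

statement-level skeleton of published theorems with citation tags; proofs where landed; nothing here is a claim about the Yang–Mills mass gap

THE PRINTED TEXT.  p. 326 [PDF 28], verbatim: *"In particular, let us assume that for the unit lattice field v, |v(∂p) − 1| ≤ e_k𝓅(e_k),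
(7.3.1) where 𝓅(e_k) = (1 + ln e_k^{−1})^𝓅. Then the stability estimate can be stated in two forms. For constants γ > 0, α > 0, M < ∞,
⟨φ, Δ_k(u_k)φ⟩ ≥ γΣ_{b∈T₁^{(k)}}|u_k(b)φ(b₊) − φ(b₋)|² − Me_k^{2−α}Σ_{x∈T₁^{(k)}}|φ(x)|². (7.3.2) The second form of the inequality substitutes
v_b for u_k(b) in the covariant derivative of φ."*

WHY A THIRD FILE.  The tree's k-uniform theorems of the row — p33 g8's `BIJ85Claim73AllTori.claim73_allTori` (first printed form) and
gen 11's `BIJ85LineSumReflectionD.claim73_second_closed_allTori_uniform` (second printed form) — index the family by p33 g7's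
`ClosedIdx d K_R 𝓅` / p11's `SecClosedIdx d K_R K_T 𝓅`, whose field `hsmall : e𝓅(e) ≤ ½` is the small-field REGIME in which the source
`f^{(k)}` of the background is closed (`BIJ85Claim73Closed.dPlaq_plaqField_eq_zero`).  The printed claim carries no such qualifier, and
none is needed: OUTSIDE that regime (7.3.2) is trivial — `⟨φ, Δ_k(u_k)φ⟩ ≥ 0` for every background (the form (4.6.4) is an infimum of
non-negative quantities, p33 g3's `BIJ85BlockAveragingIneq.inner_deltaOp_nonneg`), `Σ_b|w_bφ(b₊) − φ(b₋)|² ≤ 4d·Σ_x|φ(x)|²` for any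
`U(1)`-valued `w` (p11's `BIJ85Ineq732Flat.bondForm_le`), and `e𝓅(e) > ½` with `0 < e ≤ 1` forces `e^{2−α} = e^{3/2} > 1/(4(1+4𝓅₊)^{2𝓅₊})`
(p11's `BIJ85Ineq732General.sq_hyp731_le`), so the subtracted term dominates once `M ≥ 16dγ(1+4𝓅₊)^{2𝓅₊}`.  This file performs that
case split once and for all over a HYPOTHESIS-FREE index `AllIdx d L` whose fields are exactly the raw data `(P, k, e_k, v)`.

WHAT THIS FILE PROVES (0 `sorry`; no `Prop` fact; standing range `k ≤ m + K`).
* §1 `AllIdx d L` (index = raw data), its actual background `u_k` (4.5.4) and THE inverse `G_k(u_k)` (4.6.2); the two model instances of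
  r15's carrier `allStabData` (first printed form) / `allSecStabData` (second printed form); in the regime `e𝓅(e) ≤ ½` they ARE the data
  of `ClosedIdx` / `SecClosedIdx` at the hypothesis-free constants (`closedStabData_toClosedIdx`, `secClosedStabData_toSecClosedIdx`: `rfl`).
* §2 the large-coupling regime: `ineq732_of_deltaForm_nonneg` (abstract carrier), `one_lt_of_not_small`.
* §3 **`claim73_allCouplings`** (first printed form) and **`claim73_second_allCouplings`** (second printed form, odd `L > 1`): `Claim73 𝓅`
  for the family of ALL actual data over `AllIdx d L`, constants `γ = min(a/(9(d+1)), 1/12)` (halved in the second form), `α = ½`,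
  `M` explicit in `d`, `𝓅`, the all-tori `K_R` (p33 `exists_KR_allTori`, [6I] Prop. 1.2 inside) and `K_T` (gen 11 `exists_KT_uniform_allTori`);
  pointwise unpackings `ineq732_actual_allCouplings`, `ineq732_second_actual_allCouplings`.
HONEST SCOPE.  (i) Nothing new is proved about the small-field regime: there the theorems are the cited ones.  The complement regime is
settled by positivity, which is a remark on the CONTENT of the printed inequality (its right side is non-positive there), not a
rendering of print's *"extension of the proofs of [7]"*.  (ii) `U(1)` (the paper's abelian Higgs model), real `a > 0` = the printed `a`
of (4.6.4) (it also feeds the all-tori `K_R`, which accepts any positive parameter), torus, standing range, operators OF RECORD,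
`0 < e_k ≤ 1` (for `e_k > 1` the printed `ln e_k^{−1} < 0` and (7.3.1) is not the intended hypothesis); the second form on the tori of
the tree's centred conventions with odd `L > 1` (gen 10/11).  (iii) Constants explicit and far from optimal.  No statement weakened,
no typed slot altered; nothing here is summit progress.

CITATION HEADER (lean-in-tree rule).  Phase-2 file of the lit-balaban TYPED SKELETON (HOME `run/shared/lean/pub/lit-balaban/`), seat
p33 gen 11 (unit `lit-balaban-p33-g11`; owner r15, referee ref-5).
-/

open scoped BigOperators RealInnerProductSpace
open Finset

namespace Literature.MathematicalPhysics.QuantumFieldTheory.BalabanImbrieJaffe1984to88.BIJ85Claim73AllCouplings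

open Literature.MathematicalPhysics.QuantumFieldTheory.Balaban1983to89 hiding Site Plaq
open BIJ88Sect3Statements (U1 toC)
open BIJ85Sect1Model (U1Field plaq)
open BIJ85BlockAveragesTorusK BIJ85ScalarPropagatorTorus BIJ85ScalarPropagatorTorusK
open BIJ85ScalarForm464 BIJ85BlockAveragingIneq BIJ85Ineq732Flat BIJ85Ineq732General
open BIJ85Sigma421Torus (toU)
open BIJ85Eq454PlaqResidual (resE actualBgU1)
open BIJ85Ineq732SecondForm (lineSumIter)
open BIJ88Eq541Base0 (TkF)
open BIJ85Claim73Closed (dPlaq ClosedIdx closedStabData ineq732_closedStabData)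
open BIJ85Claim73SecondForm (vK SecClosedIdx secClosedStabData ineq732_secClosedStabData)
open BIJ85Claim73AllTori (exists_KR_allTori)
open BIJ85LineSumReflectionD (isClosedPlaq_iff_dPlaq exists_KT_uniform_allTori)
open BIJ85Sect7Statements (ScalarStabData)
open Balaban1983to89 renaming Site → TSite, Plaq → TPlaq

noncomputable section

/-! ## §1  The hypothesis-free index and the two actual data -/

/-- Index of the family of ALL actual Sect. 7.3 data of dimension `d` and block size `L`: any torus `P` of the series with `P.d = d`,
`P.L = L` (any volume exponent `m`, any number of steps `K`), any scale `1 ≤ k ≤ m + K`, ANY coupling `0 < e_k ≤ 1`, ANY unit-lattice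
`U(1)` field `v` on `T^{(k)}` — no located hypothesis, no regime qualifier. [cite: BalabanImbrieJaffe1985, (7.3.1) p.326] -/
structure AllIdx (d L : ℕ) where
  P : Params
  hd : P.d = d
  hL : P.L = L
  hd2 : 2 ≤ P.d
  k : ℕ
  hk1 : 1 ≤ k
  hk : k ≤ P.m + P.K
  e : ℝ
  he : 0 < e
  he1 : e ≤ 1
  v : U1Field P k

namespace AllIdx

variable {d L : ℕ}

/-- kernel: the level-`0` form of the standing range, `0 + k ≤ m + K`. [cite: BalabanImbrieJaffe1985, (4.5.4) p.313] -/
theorem hk0 (i : AllIdx d L) : 0 + i.k ≤ i.P.m + i.P.K := by have := i.hk; omega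

/-- kernel: the printed `a_k > 0` (`L ≥ 3`, `k ≥ 1`). [cite: BalabanImbrieJaffe1985, (4.6.4) p.313] -/
theorem aK_pos (i : AllIdx d L) {a : ℝ} (ha : 0 < a) : 0 < BIJ85Sect4Statements.aK a i.P.L i.k :=
  (BIJ85CoefficientAk464.aK_pos_le ha (by linarith [three_le_L i.P]) i.hk1).1

/-- the actual background `u_k` (4.5.4) of the index, computed from `v` with the operators of record (p33's `actualBgU1`).
[cite: BalabanImbrieJaffe1985, (4.5.4) p.313] -/
def U (i : AllIdx d L) : GaugeField i.P 0 U1 := actualBgU1 i.hd2 i.k i.e i.v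

/-- **in the regime `e𝓅(e) ≤ ½` an index is a closed-field index** at any residual constant `K_R` it satisfies (the raw data are copied;
used with p33's hypothesis-free all-tori `K_R`). [cite: BalabanImbrieJaffe1985, (7.3.1) p.326] -/
def toClosedIdx (i : AllIdx d L) {KR pexp : ℝ} (hsmall : i.e * (1 + Real.log i.e⁻¹) ^ pexp ≤ 1 / 2)
    (hR : ∀ (g : TPlaq i.P i.k → ℝ),
      (∀ (x : TSite i.P i.k) (μ ν lam : Fin i.P.d) (hμν : μ < ν) (hνl : ν < lam), dPlaq g x hμν hνl = 0) →
      ∀ (C : ℝ), (∀ q, |g q| ≤ C) →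
        ∀ p : TPlaq i.P 0, |resE i.hd2 ((i.P.eta i.k) ^ i.P.d) (i.P.eta i.k)⁻¹ i.k (toU i.P i.k g) p| ≤
          KR * Real.sqrt ((i.P.eta i.k) ^ i.P.d) * C) :
    ClosedIdx d KR pexp where
  P := i.P
  hd := i.hd
  hd2 := i.hd2
  k := i.k
  hk1 := i.hk1
  hk := i.hk
  e := i.e
  he := i.he
  he1 := i.he1
  hsmall := hsmall
  v := i.v
  hR := hR

/-- **in the regime `e𝓅(e) ≤ ½` an index is an index of p11's second-form family** at any `(K_R, K_T)` it satisfies.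
[cite: BalabanImbrieJaffe1985, (7.3.1) p.326] -/
def toSecClosedIdx (i : AllIdx d L) {KR KT pexp : ℝ} (hsmall : i.e * (1 + Real.log i.e⁻¹) ^ pexp ≤ 1 / 2)
    (hR : ∀ (g : TPlaq i.P i.k → ℝ),
      (∀ (x : TSite i.P i.k) (μ ν lam : Fin i.P.d) (hμν : μ < ν) (hνl : ν < lam), dPlaq g x hμν hνl = 0) →
      ∀ (C : ℝ), (∀ q, |g q| ≤ C) →
        ∀ p : TPlaq i.P 0, |resE i.hd2 ((i.P.eta i.k) ^ i.P.d) (i.P.eta i.k)⁻¹ i.k (toU i.P i.k g) p| ≤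
          KR * Real.sqrt ((i.P.eta i.k) ^ i.P.d) * C)
    (hT : ∀ (g : TPlaq i.P i.k → ℝ),
      (∀ (x : TSite i.P i.k) (μ ν lam : Fin i.P.d) (hμν : μ < ν) (hνl : ν < lam), dPlaq g x hμν hνl = 0) →
      ∀ (C : ℝ), (∀ q, |g q| ≤ C) →
        ∀ c : PBond i.P (0 + i.k), i.P.eta i.k * |lineSumIter (TkF i.P i.hd2 ((i.P.eta i.k) ^ i.P.d) (i.P.eta i.k) i.k g) i.k c| ≤
          KT * C) :
    SecClosedIdx d KR KT pexp where
  toClosedIdx := i.toClosedIdx hsmall hR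
  hT := hT

end AllIdx

variable {d L : ℕ}

/-- `G_k(u_k)`: THE inverse (4.6.2) at the actual background of the index (p11's `exists_GK`, `Classical.choose` — the same term as p33
g7's `closedG` at the copied data). [cite: BalabanImbrieJaffe1985, (4.6.2) p.313] -/
def allG (a : ℝ) (ha : 0 < a) (i : AllIdx d L) : FineSp i.P 0 →ₗ[ℝ] FineSp i.P 0 :=
  Classical.choose (exists_GK i.hk0 (cPhys_pos i.P i.k).ne' (i.aK_pos ha) i.U)

/-- kernel: `allG` is a right inverse of `D_u^*D_u + a_kQ_k(u)^*Q_k(u)` at `u = u_k`. [cite: BalabanImbrieJaffe1985, (4.6.2) p.313] -/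
theorem allG_spec (a : ℝ) (ha : 0 < a) (i : AllIdx d L) (φ : FineSp i.P 0) :
    opT (Dlin (cPhys i.P i.k) i.U) (QlinK i.U i.k) (BIJ85Sect4Statements.aK a i.P.L i.k) (allG a ha i φ) = φ :=
  (Classical.choose_spec (exists_GK i.hk0 (cPhys_pos i.P i.k).ne' (i.aK_pos ha) i.U)).1 φ

/-- **THE ACTUAL Sect. 7.3 DATUM, FIRST PRINTED FORM**, at an index (as p33's `closedStabData`/`resStabData`): plaquettes of `T₁^{(k)}` with
the printed deviation `|v(∂p′) − 1|`, bonds/sites of the unit lattice, `ψ ∈ ℓ²(T₁^{(k)})`, `covDiffSq ψ b = |u_k(b)ψ(b₊) − ψ(b₋)|²` with the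
transport of the ACTUAL `u_k` along `b`, `absSq ψ x = |ψ(x)|²`, `deltaForm ψ = ⟨ψ, Δ_k(u_k)ψ⟩` (printed `a_k`, physical normalization, THE
inverse (4.6.2)), `ek = e_k`. [cite: BalabanImbrieJaffe1985, (7.3.2) p.326] -/
def allStabData (a : ℝ) (ha : 0 < a) (i : AllIdx d L) : ScalarStabData where
  Plaq := TPlaq i.P i.k
  Bond := PBond i.P (0 + i.k)
  Site := TSite i.P (0 + i.k)
  Scalar := CoarseSpK i.P 0 i.k
  ek := i.e
  plaqDev := fun p => ‖((plaq i.v p : Circle) : ℂ) - 1‖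
  covDiffSq := fun ψ b => ‖toC (lineIter i.U i.k b) * ψ b.tgt - ψ b.src‖ ^ 2
  absSq := fun ψ x => ‖ψ x‖ ^ 2
  deltaForm := fun ψ => ⟪ψ, deltaOp (QlinK i.U i.k) (BIJ85Sect4Statements.aK a i.P.L i.k) (allG a ha i) ψ⟫

/-- **THE ACTUAL Sect. 7.3 DATUM, SECOND PRINTED FORM**, at an index (as p11's `secClosedStabData`): the same, EXCEPT
`covDiffSq ψ b = |v_bψ(b₊) − ψ(b₋)|²` — *"The second form of the inequality substitutes v_b for u_k(b)"*. [cite: BalabanImbrieJaffe1985, (7.3.2) p.326] -/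
def allSecStabData (a : ℝ) (ha : 0 < a) (i : AllIdx d L) : ScalarStabData where
  Plaq := TPlaq i.P i.k
  Bond := PBond i.P (0 + i.k)
  Site := TSite i.P (0 + i.k)
  Scalar := CoarseSpK i.P 0 i.k
  ek := i.e
  plaqDev := fun p => ‖((plaq i.v p : Circle) : ℂ) - 1‖
  covDiffSq := fun ψ b => ‖toC (vK i.k i.v b) * ψ b.tgt - ψ b.src‖ ^ 2
  absSq := fun ψ x => ‖ψ x‖ ^ 2
  deltaForm := fun ψ => ⟪ψ, deltaOp (QlinK i.U i.k) (BIJ85Sect4Statements.aK a i.P.L i.k) (allG a ha i) ψ⟫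

/-- kernel: in the regime `e𝓅(e) ≤ ½` the first-form datum of an index IS p33 g7's closed-field datum of the copied index (same
background, same chosen inverse) — definitionally. [cite: BalabanImbrieJaffe1985, (7.3.2) p.326] -/
theorem closedStabData_toClosedIdx (a : ℝ) (ha : 0 < a) (i : AllIdx d L) {KR pexp : ℝ}
    (hsmall : i.e * (1 + Real.log i.e⁻¹) ^ pexp ≤ 1 / 2)
    (hR : ∀ (g : TPlaq i.P i.k → ℝ),
      (∀ (x : TSite i.P i.k) (μ ν lam : Fin i.P.d) (hμν : μ < ν) (hνl : ν < lam), dPlaq g x hμν hνl = 0) →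
      ∀ (C : ℝ), (∀ q, |g q| ≤ C) →
        ∀ p : TPlaq i.P 0, |resE i.hd2 ((i.P.eta i.k) ^ i.P.d) (i.P.eta i.k)⁻¹ i.k (toU i.P i.k g) p| ≤
          KR * Real.sqrt ((i.P.eta i.k) ^ i.P.d) * C) :
    closedStabData a ha (i.toClosedIdx hsmall hR) = allStabData a ha i := rfl

/-- kernel: in the regime `e𝓅(e) ≤ ½` the second-form datum of an index IS p11's `secClosedStabData` of the copied index — definitionally.
[cite: BalabanImbrieJaffe1985, (7.3.2) p.326] -/
theorem secClosedStabData_toSecClosedIdx (a : ℝ) (ha : 0 < a) (i : AllIdx d L) {KR KT pexp : ℝ}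
    (hsmall : i.e * (1 + Real.log i.e⁻¹) ^ pexp ≤ 1 / 2)
    (hR : ∀ (g : TPlaq i.P i.k → ℝ),
      (∀ (x : TSite i.P i.k) (μ ν lam : Fin i.P.d) (hμν : μ < ν) (hνl : ν < lam), dPlaq g x hμν hνl = 0) →
      ∀ (C : ℝ), (∀ q, |g q| ≤ C) →
        ∀ p : TPlaq i.P 0, |resE i.hd2 ((i.P.eta i.k) ^ i.P.d) (i.P.eta i.k)⁻¹ i.k (toU i.P i.k g) p| ≤
          KR * Real.sqrt ((i.P.eta i.k) ^ i.P.d) * C)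
    (hT : ∀ (g : TPlaq i.P i.k → ℝ),
      (∀ (x : TSite i.P i.k) (μ ν lam : Fin i.P.d) (hμν : μ < ν) (hνl : ν < lam), dPlaq g x hμν hνl = 0) →
      ∀ (C : ℝ), (∀ q, |g q| ≤ C) →
        ∀ c : PBond i.P (0 + i.k), i.P.eta i.k * |lineSumIter (TkF i.P i.hd2 ((i.P.eta i.k) ^ i.P.d) (i.P.eta i.k) i.k g) i.k c| ≤
          KT * C) :
    secClosedStabData a ha (i.toSecClosedIdx hsmall hR hT) = allSecStabData a ha i := rfl

/-- kernel: the hypothesis of either family at an index IS the printed (7.3.1) on the unit-lattice field `v`.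
[cite: BalabanImbrieJaffe1985, (7.3.1) p.326] -/
theorem hyp731_iff (a : ℝ) (ha : 0 < a) (pexp : ℝ) (i : AllIdx d L) :
    ((allStabData a ha i).Hyp731 pexp ↔ ∀ p' : TPlaq i.P i.k, ‖((plaq i.v p' : Circle) : ℂ) - 1‖ ≤ i.e * (1 + Real.log i.e⁻¹) ^ pexp) ∧
    ((allSecStabData a ha i).Hyp731 pexp ↔ ∀ p' : TPlaq i.P i.k, ‖((plaq i.v p' : Circle) : ℂ) - 1‖ ≤ i.e * (1 + Real.log i.e⁻¹) ^ pexp) :=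
  ⟨Iff.rfl, Iff.rfl⟩

/-! ## §2  The large-coupling regime `e𝓅(e) > ½`: (7.3.2) by positivity -/

/-- **(7.3.2) by positivity** (abstract carrier): if `⟨φ, Δφ⟩ ≥ 0`, `Σ_b covDiffSq ≤ B·Σ_x absSq`, `1 ≤ t·e_k^{2−α}` and `γBt ≤ M`
(`γ, B ≥ 0`, `e_k ≥ 0`), then `Ineq732 γ α M` holds — its left side is non-positive. [cite: BalabanImbrieJaffe1985, (7.3.2) p.326] -/
theorem ineq732_of_deltaForm_nonneg (D : ScalarStabData) {γ α M B t : ℝ} (hγ : 0 ≤ γ) (hB : 0 ≤ B)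
    (hek : 0 ≤ D.ek) (hcov : ∀ φ, ∑ b, D.covDiffSq φ b ≤ B * ∑ x, D.absSq φ x) (habs : ∀ φ, 0 ≤ ∑ x, D.absSq φ x)
    (hdelta : ∀ φ, 0 ≤ D.deltaForm φ) (hte : 1 ≤ t * D.ek ^ (2 - α)) (hM : γ * B * t ≤ M) :
    D.Ineq732 γ α M := by
  intro φ
  have hS := habs φ
  have hE : 0 ≤ D.ek ^ (2 - α) := Real.rpow_nonneg hek _
  have h1 : γ * ∑ b, D.covDiffSq φ b ≤ γ * B * ∑ x, D.absSq φ x := by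
    rw [mul_assoc]; exact mul_le_mul_of_nonneg_left (hcov φ) hγ
  have h2 : γ * B * ∑ x, D.absSq φ x ≤ γ * B * (∑ x, D.absSq φ x) * (t * D.ek ^ (2 - α)) :=
    le_mul_of_one_le_right (mul_nonneg (mul_nonneg hγ hB) hS) hte
  have h3 : γ * B * (∑ x, D.absSq φ x) * (t * D.ek ^ (2 - α)) ≤ M * D.ek ^ (2 - α) * ∑ x, D.absSq φ x := by
    have : γ * B * (∑ x, D.absSq φ x) * (t * D.ek ^ (2 - α)) = γ * B * t * (D.ek ^ (2 - α) * ∑ x, D.absSq φ x) := by ring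
    rw [this, mul_assoc M]
    exact mul_le_mul_of_nonneg_right hM (mul_nonneg hE hS)
  linarith [hdelta φ]

/-- kernel: outside the regime, `1 < 4(1+4𝓅₊)^{2𝓅₊}·e^{3/2}` — `¼ < (e𝓅(e))² ≤ (1+4𝓅₊)^{2𝓅₊}e^{3/2}` (p11's `sq_hyp731_le`, `0 < e ≤ 1`).
[cite: BalabanImbrieJaffe1985, (7.3.1) p.326] -/
theorem one_lt_of_not_small (pexp : ℝ) {e : ℝ} (he : 0 < e) (he1 : e ≤ 1) (h : ¬ e * (1 + Real.log e⁻¹) ^ pexp ≤ 1 / 2) :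
    1 < 4 * (1 + 4 * max pexp 0) ^ (2 * max pexp 0) * e ^ (2 - 1 / 2 : ℝ) := by
  have hlt : 1 / 2 < e * (1 + Real.log e⁻¹) ^ pexp := lt_of_not_ge h
  have hsq : (1 / 2 : ℝ) ^ 2 < (e * (1 + Real.log e⁻¹) ^ pexp) ^ 2 := by
    have h0 : (0 : ℝ) ≤ 1 / 2 := by norm_num
    nlinarith
  have := sq_hyp731_le pexp he he1
  nlinarith

/-- kernel: `Σ_b |w_bψ(b₊) − ψ(b₋)|² ≤ 4d·Σ_x|ψ(x)|²` for a `U(1)`-valued unit bond field `w` (p11's `bondForm_le`).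
[cite: BalabanImbrieJaffe1985, (7.3.2) p.326] -/
theorem sum_covDiffSq_le {P : Params} {n : ℕ} (W : GaugeField P n U1) (ψ : PiLp 2 (fun _ : TSite P n => ℂ)) :
    ∑ b : PBond P n, ‖toC (W b) * ψ b.tgt - ψ b.src‖ ^ 2 ≤ 4 * P.d * ∑ x : TSite P n, ‖ψ x‖ ^ 2 := by
  rw [sum_norm_sq_eq]
  exact bondForm_le W ψ

/-- `0 ≤ C` whenever `|g| ≤ C` on the (non-empty, `d ≥ 2`) set of unit plaquettes. [folklore] -/
private theorem nonneg_of_bound' {P : Params} (hd : 2 ≤ P.d) {k : ℕ} {g : TPlaq P k → ℝ} {C : ℝ} (hg : ∀ q, |g q| ≤ C) : 0 ≤ C :=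
  (abs_nonneg _).trans (hg ⟨default, ⟨0, by omega⟩, ⟨1, by omega⟩, by simp [Fin.lt_def]⟩)

/-! ## §3  `Claim73 𝓅` over ALL actual data, both printed forms -/

section Main

/-- **r15's `Claim73 𝓅`, FIRST PRINTED FORM, FOR THE FAMILY OF ALL ACTUAL Sect. 7.3 DATA OF DIMENSION `d ≥ 2` AND BLOCK SIZE `L` —
NO LOCATED HYPOTHESIS, NO REGIME QUALIFIER**: for every `a > 0` (the printed `a` of (4.6.4)) and `𝓅` there are constants
`γ = min(a/(9(d+1)), 1/12) > 0`, `α = ½`, `M < ∞` such that for EVERY torus `P` with `P.d = d`, `P.L = L`, every scale `1 ≤ k ≤ m + K`,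
every coupling `0 < e_k ≤ 1` and every unit-lattice `U(1)` field `v`: (7.3.1) ⇒ (7.3.2) (first form) for `⟨ψ, Δ_k(u_k)ψ⟩` at the actual
background `u_k` computed from `v`.  Regime `e𝓅(e) ≤ ½`: p33's `ineq732_closedStabData` at the hypothesis-free all-tori `K_R`
(`exists_KR_allTori`, [6I] Prop. 1.2 inside); regime `e𝓅(e) > ½`: §2. [cite: BalabanImbrieJaffe1985, (7.3.1)–(7.3.2) p.326] -/
theorem claim73_allCouplings (hd : 2 ≤ d) (a₀ : ℝ) (ha₀ : 0 < a₀) (pexp : ℝ) :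
    ScalarStabData.Claim73 pexp (allStabData (d := d) (L := L) a₀ ha₀) := by
  obtain ⟨KR, _, hKR⟩ := exists_KR_allTori (d := d) (L := L) hd ha₀
  set γ : ℝ := min (a₀ / (9 * (d + 1))) (1 / 12) with hγdef
  set A : ℝ := (1 + 4 * max pexp 0) ^ (2 * max pexp 0) with hAdef
  set M₁ : ℝ := 4 / 3 * (d : ℝ) ^ 4 * (Real.pi / 2 * KR) ^ 2 * A with hM₁def
  have hγ : 0 < γ := lt_min (by positivity) (by norm_num)
  have hA : 0 ≤ A := by
    have : (0 : ℝ) ≤ 1 + 4 * max pexp 0 := by positivity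
    exact Real.rpow_nonneg this _
  have hM₁ : 0 ≤ M₁ := by positivity
  refine ⟨γ, 1 / 2, M₁ + 16 * d * γ * A, hγ, by norm_num, fun i hi => ?_⟩
  have hd' : (i.P.d : ℝ) = d := by rw [i.hd]
  by_cases hsmall : i.e * (1 + Real.log i.e⁻¹) ^ pexp ≤ 1 / 2
  · -- the small-field regime: the closed-field index at the all-tori `K_R`
    have hR : ∀ (g : TPlaq i.P i.k → ℝ),
        (∀ (x : TSite i.P i.k) (μ ν lam : Fin i.P.d) (hμν : μ < ν) (hνl : ν < lam), dPlaq g x hμν hνl = 0) →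
        ∀ (C : ℝ), (∀ q, |g q| ≤ C) →
          ∀ p : TPlaq i.P 0, |resE i.hd2 ((i.P.eta i.k) ^ i.P.d) (i.P.eta i.k)⁻¹ i.k (toU i.P i.k g) p| ≤
            KR * Real.sqrt ((i.P.eta i.k) ^ i.P.d) * C :=
      fun g hg C hC p => hKR i.P i.hd i.hL i.k i.hk1 i.hk g ((isClosedPlaq_iff_dPlaq g).2 hg) C (nonneg_of_bound' i.hd2 hC) hC p
    have h1 : (allStabData a₀ ha₀ i).Ineq732 γ (1 / 2) M₁ := by
      rw [← closedStabData_toClosedIdx a₀ ha₀ i hsmall hR]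
      exact ineq732_closedStabData a₀ ha₀ (i.toClosedIdx hsmall hR) hi
    intro ψ
    have h2 := h1 ψ
    have hS : 0 ≤ ∑ x, (allStabData a₀ ha₀ i).absSq ψ x := sum_nonneg fun x _ => by exact pow_nonneg (norm_nonneg _) 2
    have hE : 0 ≤ (allStabData a₀ ha₀ i).ek ^ (2 - 1 / 2 : ℝ) := Real.rpow_nonneg i.he.le _
    have hc : (0 : ℝ) ≤ 16 * d * γ * A := by positivity
    have hextra : 0 ≤ 16 * d * γ * A * (allStabData a₀ ha₀ i).ek ^ (2 - 1 / 2 : ℝ) * ∑ x, (allStabData a₀ ha₀ i).absSq ψ x :=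
      mul_nonneg (mul_nonneg hc hE) hS
    linarith [h2, hextra]
  · -- the large-coupling regime: positivity
    have ht := one_lt_of_not_small pexp i.he i.he1 hsmall
    refine ineq732_of_deltaForm_nonneg (allStabData a₀ ha₀ i) (B := 4 * d) (t := 4 * A) hγ.le (by positivity)
      i.he.le (fun ψ => ?_) (fun ψ => sum_nonneg fun x _ => by exact pow_nonneg (norm_nonneg _) 2) (fun ψ => ?_) ?_ ?_
    · have h := sum_covDiffSq_le (lineIter i.U i.k) ψ
      rw [hd'] at h
      exact h
    · exact inner_deltaOp_nonneg (allG_spec a₀ ha₀ i) (i.aK_pos ha₀).le ψ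
    · show 1 ≤ 4 * A * i.e ^ (2 - 1 / 2 : ℝ)
      rw [hAdef]; exact ht.le
    · nlinarith [hM₁, hγ.le, hA]

/-- **r15's `Claim73 𝓅`, SECOND PRINTED FORM, FOR THE FAMILY OF ALL ACTUAL Sect. 7.3 DATA OF DIMENSION `d ≥ 2` AND ODD BLOCK SIZE
`L > 1` — NO LOCATED HYPOTHESIS, NO REGIME QUALIFIER**: for every `a > 0` (the printed `a` of (4.6.4)) and `𝓅`, constants
`γ = min(a/(9(d+1)), 1/12)/2`, `α = ½`, `M` explicit in `d`, `𝓅`, the hypothesis-free all-tori `K_R` (p33 `exists_KR_allTori`) and the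
k-uniform `K_T` (gen 11 `exists_KT_uniform_allTori`); for EVERY torus `P` with `P.d = d`, `P.L = L`, every `1 ≤ k ≤ m + K`, every
`0 < e_k ≤ 1`, every `v`: (7.3.1) ⇒ (7.3.2) with `v_b` substituted for `u_k(b)`.  Regime `e𝓅(e) ≤ ½`: p11's `ineq732_secClosedStabData`;
regime `e𝓅(e) > ½`: §2. [cite: BalabanImbrieJaffe1985, (7.3.1)–(7.3.2) p.326] -/
theorem claim73_second_allCouplings (hdd : 2 ≤ d) (hL : Odd L ∧ 1 < L) (a₀ : ℝ) (ha₀ : 0 < a₀) (pexp : ℝ) :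
    ScalarStabData.Claim73 pexp (allSecStabData (d := d) (L := L) a₀ ha₀) := by
  obtain ⟨KR, _, hKR⟩ := exists_KR_allTori (d := d) (L := L) hdd ha₀
  obtain ⟨KT, _, hKT⟩ := exists_KT_uniform_allTori hdd hL
  set γ₀ : ℝ := min (a₀ / (9 * (d + 1))) (1 / 12) with hγ₀def
  set A : ℝ := (1 + 4 * max pexp 0) ^ (2 * max pexp 0) with hAdef
  set M₂ : ℝ := (4 / 3 * (d : ℝ) ^ 4 * (Real.pi / 2 * KR) ^ 2 + γ₀ * d * (Real.pi / 2 * KT) ^ 2) * A with hM₂def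
  have hγ₀ : 0 < γ₀ := lt_min (by positivity) (by norm_num)
  have hA : 0 ≤ A := by
    have : (0 : ℝ) ≤ 1 + 4 * max pexp 0 := by positivity
    exact Real.rpow_nonneg this _
  have hM₂ : 0 ≤ M₂ := by positivity
  refine ⟨γ₀ / 2, 1 / 2, M₂ + 16 * d * (γ₀ / 2) * A, half_pos hγ₀, by norm_num, fun i hi => ?_⟩
  have hd' : (i.P.d : ℝ) = d := by rw [i.hd]
  by_cases hsmall : i.e * (1 + Real.log i.e⁻¹) ^ pexp ≤ 1 / 2
  · -- the small-field regime: p11's second-form index at the all-tori `(K_R, K_T)`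
    have hR : ∀ (g : TPlaq i.P i.k → ℝ),
        (∀ (x : TSite i.P i.k) (μ ν lam : Fin i.P.d) (hμν : μ < ν) (hνl : ν < lam), dPlaq g x hμν hνl = 0) →
        ∀ (C : ℝ), (∀ q, |g q| ≤ C) →
          ∀ p : TPlaq i.P 0, |resE i.hd2 ((i.P.eta i.k) ^ i.P.d) (i.P.eta i.k)⁻¹ i.k (toU i.P i.k g) p| ≤
            KR * Real.sqrt ((i.P.eta i.k) ^ i.P.d) * C :=
      fun g hg C hC p => hKR i.P i.hd i.hL i.k i.hk1 i.hk g ((isClosedPlaq_iff_dPlaq g).2 hg) C (nonneg_of_bound' i.hd2 hC) hC p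
    have hT : ∀ (g : TPlaq i.P i.k → ℝ),
        (∀ (x : TSite i.P i.k) (μ ν lam : Fin i.P.d) (hμν : μ < ν) (hνl : ν < lam), dPlaq g x hμν hνl = 0) →
        ∀ (C : ℝ), (∀ q, |g q| ≤ C) →
          ∀ c : PBond i.P (0 + i.k),
            i.P.eta i.k * |lineSumIter (TkF i.P i.hd2 ((i.P.eta i.k) ^ i.P.d) (i.P.eta i.k) i.k g) i.k c| ≤ KT * C :=
      fun g hg C hC c => hKT i.P i.hd i.hL i.hd2 i.k i.hk g ((isClosedPlaq_iff_dPlaq g).2 hg) C hC c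
    have h1 : (allSecStabData a₀ ha₀ i).Ineq732 (γ₀ / 2) (1 / 2) M₂ := by
      rw [← secClosedStabData_toSecClosedIdx a₀ ha₀ i hsmall hR hT]
      exact ineq732_secClosedStabData a₀ ha₀ (i.toSecClosedIdx hsmall hR hT) hi
    intro ψ
    have h2 := h1 ψ
    have hS : 0 ≤ ∑ x, (allSecStabData a₀ ha₀ i).absSq ψ x := sum_nonneg fun x _ => by exact pow_nonneg (norm_nonneg _) 2
    have hE : 0 ≤ (allSecStabData a₀ ha₀ i).ek ^ (2 - 1 / 2 : ℝ) := Real.rpow_nonneg i.he.le _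
    have hc : (0 : ℝ) ≤ 16 * d * (γ₀ / 2) * A := by positivity
    have hextra : 0 ≤ 16 * d * (γ₀ / 2) * A * (allSecStabData a₀ ha₀ i).ek ^ (2 - 1 / 2 : ℝ) *
        ∑ x, (allSecStabData a₀ ha₀ i).absSq ψ x :=
      mul_nonneg (mul_nonneg hc hE) hS
    linarith [h2, hextra]
  · -- the large-coupling regime: positivity
    have ht := one_lt_of_not_small pexp i.he i.he1 hsmall
    refine ineq732_of_deltaForm_nonneg (allSecStabData a₀ ha₀ i) (B := 4 * d) (t := 4 * A) (half_pos hγ₀).le (by positivity)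
      i.he.le (fun ψ => ?_) (fun ψ => sum_nonneg fun x _ => by exact pow_nonneg (norm_nonneg _) 2) (fun ψ => ?_) ?_ ?_
    · have h := sum_covDiffSq_le (vK i.k i.v) ψ
      rw [hd'] at h
      exact h
    · exact inner_deltaOp_nonneg (allG_spec a₀ ha₀ i) (i.aK_pos ha₀).le ψ
    · show 1 ≤ 4 * A * i.e ^ (2 - 1 / 2 : ℝ)
      rw [hAdef]; exact ht.le
    · nlinarith [hM₂, hγ₀.le, hA]

/-- **(7.3.2), FIRST PRINTED FORM, AT EVERY ACTUAL DATUM — pointwise unpacking of `claim73_allCouplings`**: one triple `(γ, α, M)` for the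
dimension `d ≥ 2`, the block size `L`, `a`, `𝓅`; then for every torus `P` with `P.d = d`, `P.L = L`, every `1 ≤ k ≤ m + K`, every
`0 < e ≤ 1` and every unit field `v` with `|v(∂p′) − 1| ≤ e𝓅(e)` for all `p′`:
`γ·Σ_b|u_k(b)ψ(b₊) − ψ(b₋)|² − M·e^{2−α}·Σ_x|ψ(x)|² ≤ ⟨ψ, Δ_k(u_k)ψ⟩` for every `ψ`. [cite: BalabanImbrieJaffe1985, (7.3.1)–(7.3.2) p.326] -/
theorem ineq732_actual_allCouplings (hd : 2 ≤ d) (a₀ : ℝ) (ha₀ : 0 < a₀) (pexp : ℝ) :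
    ∃ γ α M : ℝ, 0 < γ ∧ 0 < α ∧ ∀ (P : Params) (hPd : P.d = d) (hPL : P.L = L) (hd2 : 2 ≤ P.d) (k : ℕ) (hk1 : 1 ≤ k)
      (hk : k ≤ P.m + P.K) (e : ℝ) (he : 0 < e) (he1 : e ≤ 1) (v : U1Field P k),
      (∀ p' : TPlaq P k, ‖((plaq v p' : Circle) : ℂ) - 1‖ ≤ e * (1 + Real.log e⁻¹) ^ pexp) →
        (allStabData a₀ ha₀ (⟨P, hPd, hPL, hd2, k, hk1, hk, e, he, he1, v⟩ : AllIdx d L)).Ineq732 γ α M := by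
  obtain ⟨γ, α, M, hγ, hα, H⟩ := claim73_allCouplings (d := d) (L := L) hd a₀ ha₀ pexp
  exact ⟨γ, α, M, hγ, hα, fun P hPd hPL hd2 k hk1 hk e he he1 v hv => H ⟨P, hPd, hPL, hd2, k, hk1, hk, e, he, he1, v⟩ hv⟩

/-- **(7.3.2), SECOND PRINTED FORM, AT EVERY ACTUAL DATUM — pointwise unpacking of `claim73_second_allCouplings`** (odd `L > 1`): one
triple `(γ, α, M)`; then for every torus `P` with `P.d = d`, `P.L = L`, every `1 ≤ k ≤ m + K`, every `0 < e ≤ 1` and every `v` with (7.3.1):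
`γ·Σ_b|v_bψ(b₊) − ψ(b₋)|² − M·e^{2−α}·Σ_x|ψ(x)|² ≤ ⟨ψ, Δ_k(u_k)ψ⟩` for every `ψ`. [cite: BalabanImbrieJaffe1985, (7.3.1)–(7.3.2) p.326] -/
theorem ineq732_second_actual_allCouplings (hdd : 2 ≤ d) (hL : Odd L ∧ 1 < L) (a₀ : ℝ) (ha₀ : 0 < a₀) (pexp : ℝ) :
    ∃ γ α M : ℝ, 0 < γ ∧ 0 < α ∧ ∀ (P : Params) (hPd : P.d = d) (hPL : P.L = L) (hd2 : 2 ≤ P.d) (k : ℕ) (hk1 : 1 ≤ k)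
      (hk : k ≤ P.m + P.K) (e : ℝ) (he : 0 < e) (he1 : e ≤ 1) (v : U1Field P k),
      (∀ p' : TPlaq P k, ‖((plaq v p' : Circle) : ℂ) - 1‖ ≤ e * (1 + Real.log e⁻¹) ^ pexp) →
        (allSecStabData a₀ ha₀ (⟨P, hPd, hPL, hd2, k, hk1, hk, e, he, he1, v⟩ : AllIdx d L)).Ineq732 γ α M := by
  obtain ⟨γ, α, M, hγ, hα, H⟩ := claim73_second_allCouplings (d := d) (L := L) hdd hL a₀ ha₀ pexp
  exact ⟨γ, α, M, hγ, hα, fun P hPd hPL hd2 k hk1 hk e he he1 v hv => H ⟨P, hPd, hPL, hd2, k, hk1, hk, e, he, he1, v⟩ hv⟩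

end Main

end

end Literature.MathematicalPhysics.QuantumFieldTheory.BalabanImbrieJaffe1984to88.BIJ85Claim73AllCouplings
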